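import Summits.HodgeConjecture.CorCM.D2Bridge.ClosedPrintedMuKeyIdentLemD3DelRecConjOmegaT
import Literature.RepresentationTheory.MoeglinVignerasWaldspurger1987.RankOneThetaLiftIrreducibleProofs   -- IV-1a DISCHARGED: B-p02 p601137 `mvw_IV4_rankOne_irreducibleOrZero_holds` (stub CLOSED BY NAME)
import Literature.NumberTheory.Automorphic.Zelevinsky1980.UnitaryCharacterInductionIrreducible              -- IV-3b DISCHARGED: B-p09 p601139 `parabolicIndGL_detChar_unitary_isIrreducible_holds` (stub CLOSED BY NAME)
import Literature.NumberTheory.Automorphic.Liu2021.SplitPlaceOscillatorModelProofs                    -- v4: IV-3a DISCHARGED: B-p08 p602828 `splitPlace_chiCoinv_iso_parabolicIndGL_of_isIrreducible : IV-3b → IV-3a` (last stub CLOSED BY NAME)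
import Summits.HodgeConjecture.HodgeConjecture.Theses.HCCMUnconditional        -- v2: the ROUTE FILE (crux HD1pp = stmt-HodgeConjecture-24838; brings the pack decls of record)
import Summits.HodgeConjecture.CorCM.HypD1pp.A4LiuD1ppHeadOfFacts               -- v2: B-p01 HEAD-TREE p599646 `lemD1AllPairs_of_facts` / `hypD1pp_of_facts` (J-TREE p598544/p598746/p598915/p599149 inside)
import HarnessLib

/-!
**v4 (A-plan2 g1, 2026-08-28 ~03:50Z) — SORRY-FREE EDITION.** v4 = v3 (67a5688a23d0205c) with the LAST residual fact stub CLOSED BY NAME: IV-3(a) `stub_splitPlace_chiCoinv_iso_parabolicIndGL := Liu2021.splitPlace_chiCoinv_iso_parabolicIndGL_of_isIrreducible Zelevinsky1980.parabolicIndGL_detChar_unitary_isIrreducible_holds` (B-p08 p602828 `IV-3b → IV-3a` fed with B-p09 p601139).  ZERO sorries: `HD1pp_proof : …Theses.HCCMUnconditional.HD1pp` is a closed term — the binder `hD1''` is DISCHARGED IN THE KERNEL (credits: B-p01 J-TREE/HEAD-TREE p599646 + p602837 `hypD1pp_of_splitPlaceModel` · B-p02 p601137 IV-1a · B-p03/B-p04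 IV-1b/IV-2 · B-p08 p602828 (+ B-p17/B-p19) IV-3a · B-p09 p601139 (+ B-p11 p600727) IV-3b · skeletons B-plan1/A-plan2).  The closing Theorems file `Theorems/HCCMUnconditionalHD1pp.lean` (`--workitem stmt-HodgeConjecture-24838`) is B-p01's (03:43:43Z).  HC_CM is proved only modulo the 7 printed citations until rung 0 closes — after HD1pp and H411 close in the route ledger, modulo 5.

**v3 (A-plan2 g1, 2026-08-28 ~03:40Z).** v3 = v2 (f2a27c1915c27bc3) with TWO of the three residual fact stubs CLOSED BY NAME after their discharge: IV-1a `stub_mvw_IV4_rankOne_irreducibleOrZero := mvw_IV4_rankOne_irreducibleOrZero_holds` (B-p02 p601137, RankOneThetaLiftIrreducibleProofs.lean) and IV-3b `stub_parabolicIndGL_detChar_unitary_isIrreducible := parabolicIndGL_detChar_unitary_isIrreducible_holds.{0}` (B-p09 p601139, UnitaryCharacterInductionIrreducible.lean).  ONE REGISTERED STUB remains: IV-3(a) `stub_splitPlace_chiCoinv_iso_parabolicIndGL` (B-p08 lead, B-p02 second) — when `splitPlace_chiCoinv_iso_parabolicIndGL_holds` lands, the slot fill makes this file sorry-free and it is proposed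 `--workitem stmt-HodgeConjecture-24838` (binder hD1'' : 7 → 6).  Statements byte-identical to v2/v1.  HC_CM is proved only modulo the 7 printed citations until rung 0 closes.

**v2 (A-plan2 g1, 2026-08-28 — REGISTRATION EDITION = the crux workfile `Cruxes/HD1pp/Lines/a4_liuD1pp.lean` on stmt-HodgeConjecture-24838).**
The fan-A ↔ fan-B junction for `hD1''` is IN THE TREE (ref3 03:05:16Z / 03:08:10Z): B-p01's J-TREE (per-place theorem
`Summit.HodgeConjecture.CorCM.HypD1pp.lemD1Item1AtV`, `isotropyRankThree`, `splitPlaceModelConsequences_of_facts`) and HEAD-TREE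
`Summit.HodgeConjecture.CorCM.HypD1pp.lemD1AllPairs_of_facts` / `hypD1pp_of_facts` (p599646; statement of the former = v1's `LemD1AllPairs` body
character for character, proof = v1's `lemD1AllPairs_of` with the closed stubs replaced by tree names; IV-1(ii) `mvw_IV4_rankOne_admissible_holds` and
IV-2 `mvw_IV2_rankOne_nonvanishing_of_isotropic_holds` are PROVED Literature theorems consumed inside).  Hence v2 = v1 (2ff805ec0320d57a) with the six
v1 stubs COLLAPSED to exactly the THREE RESIDUAL NAMED FACTS (D-0014 facts, typed, `_holds` not yet in the tree): IV-1(i) = IV-1a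
`mvw_IV4_rankOne_irreducibleOrZero` [MVW87 Ch. 3 IV.4 Thm 2)] (XL; owners B-p02/B-p04/B-p19 + c1 plan), IV-3(a) `Liu2021.splitPlace_chiCoinv_iso_parabolicIndGL`
[Liu2021 l. 5253; GR90 §2.6] (L; B-p08 lead, B-p11 second), IV-3(b) `Zelevinsky1980.parabolicIndGL_detChar_unitary_isIrreducible` [Zelevinsky1980 Thm 4.2]
(M; B-p09/B-p17, N = 2 irregular case p600727 landed) — registered as the stubs `stub_mvw_IV4_rankOne_irreducibleOrZero`,
`stub_splitPlace_chiCoinv_iso_parabolicIndGL`, `stub_parabolicIndGL_detChar_unitary_isIrreducible` — and the GATE-SHAPE HEAD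
`HD1pp_proof : Summit.HodgeConjecture.HodgeConjecture.Theses.HCCMUnconditional.HD1pp := HypD1pp_of stub₁ stub₂ stub₃` (`HypD1pp_of := hypD1pp_of_facts`).
The local copy of `HypD1pp` is DELETED (pack decl of record by name); `LemD1AllPairs` (shared with `Lines/a4-liu411.lean`) stays, now a THEOREM of the
three facts (`lemD1AllPairs_of := lemD1AllPairs_of_facts`).  Sorries: exactly the three fact stubs.  HC_CM is proved only modulo the 7 printed citations
until rung 0 closes.

--- v1 module docstring (kept for the record; «six stubs» now read «three residual facts») ---
# `Lines/a4-liuD1pp.lean` — crux skeleton for the binder `hD1''` = `PrintedCitationHypotheses.HypD1pp`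
# ([Liu 2021, Lem D.1, first sentence + item (1)] AS PRINTED, per admissible index `j` and finite place `v`, at the face datum)

Cell `hodgecm-mathlib`, fan A, rung A-IV (planner seat A-plan2).  TARGET BY NAME = the decl of record
`Summit.HodgeConjecture.CorCM.D2Bridge.MuKeyIdentLemD3DelRecConjOmegaEndT.PrintedCitationHypotheses.HypD1pp`
(`Summits/HodgeConjecture/CorCM/D2Bridge/PrintedCitationHypothesesT.lean` :109–:132) = `∀ hDel, <binder hD1'' of the headline
hc_cm_of_printed_citations_muKey_ident_lemD3_delRecConjOmegaT, ClosedPrintedMuKeyIdentLemD3DelRecConjOmegaT.lean :140–:160, verbatim>`;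
restated below character-identically as the local `HypD1pp` (switch to the import when the farm snapshot builds the pack).
**HC_CM is proved only modulo the 7 printed citations (`hDel`, `h21`, `hLiu418`, `h411`, `h413`, `hD3`, `hD1''`) until rung 0 closes;
this file removes none of them — it cuts `hD1''` into named stubs.**

## The datum, unfolded

`HypD1pp` says: for every face prefix `(F ⊇ ℚ Galois CM of degree ≥ 6, ι₁, V, a₀, Φ ∋ ι₁)`, every conjugate-symplectic weight-one `μ`, every
ADMISSIBLE index `j = ((ε, χ), _)` of the printed datum `D(μ) = toThm418Data _ (restOfCharDeltaPrime …)` and every finite place `v` of `F⁺`,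
`LemD1_1AsPrinted (localLemD1Data F⁺ F c 3 e₁ (diagonal (frameD V)) … (r_{a₀}.toFun ε) (chiLocalSplittingsD … (toHeckeCharacter μ) … (r_{a₀}.toFun ε))
(le_refl 3) (localMu μ) … χ.1 … v)` — i.e. [Lem D.1]'s first sentence + (1) AT THE PLACE `v` for the line `⟨r_{a₀}(ε)⟩`, the `χ`-attached
CM local splittings (`ι_{μ_v}` of [Liu 2021, App. D Step 2]) and the character `χ_{1,v}`: «the `χ_v`-coinvariant quotient of `ω_{μ_v, ε_v}` is
irreducible-or-zero and admissible (Howe currency), and NON-ZERO when `v` splits or `V ⊗ W_v^{ε_v}` is isotropic» (`Liu2021/LemD1AsPrinted.lean`).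
The statement is LOCAL and GENERIC in the line and the character: fan B's line `b4-lemD1-item1-at-v` (B-plan1) proves exactly
`LemD1_1AsPrinted (localLemD1Data F E c N e JV … a 𝓢 hn μ … χ₁ … v)` for ANY quadratic `E/F`, `N`, frame, line `a`, UNITARY-at-`v` family `𝓢`,
`n ≥ 3`, from the local theta correspondence for `(U(1) = centre, U(V ⊗ W))` [MVW87 Ch. 3 IV.4 / IV.2] + the split-place model [Liu 2021 l. 5253;
GR90 §2.6; Zelevinsky 1980 Thm 4.2] + isotropy of hermitian spaces of rank ≥ 3 over `E_v`.

## WHY THIS LINE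
The binder is the per-place Lem D.1 (1) and nothing more, so the line is forced: instantiate fan B's generic per-place theorem at the face
(`F ↦ F⁺`, `E ↦ F`, `N = n = 3`, `e = e₁`, `JV = diagonal (frameD V)`, `a = r_{a₀}.toFun ε`, `𝓢 = chiLocalSplittingsD …`, `μ = localMu (toHeckeCharacter μ)`,
`χ₁ = χ.1`) and discharge fan B's one non-local hypothesis — UNITARITY of the local Weil representation of the face family at `v`
(`(𝓢.omegaLoc v).IsL2Isometric`) — by the PROVED tree theorem `GRConstruction.isL2Isometric_omegaLoc_congrW_undoubledSplittings_cmFinLocalFamily`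
(GelbartRogawski1991/UndoubledSplittingsUnitary.lean:159) at `hχu := isUnitary_toHeckeCharacter F μ`, with the Haar data of record `borelPlaceMeasure`
(the very data `chiLocalSplittingsD` is built on, Item6OmegaChiSplitting.lean:135).  The face instantiation + discharge is the sorry-free
`lemD1AllPairs_of` / `HypD1pp_of` below; everything printed lives in the six registered stubs, FIVE of which are fan B's stubs VERBATIM (shared
statements ⇒ one proof closes both lines) and the sixth (`stub_lemD1_item1_at_v`) is fan B's kernel-checked COMPOSITION restated as a closed
statement (B-plan/lines/b4-lemD1-item1-at-v.lean v5 sha16 75144479545f1e0e, `lemD1_1AsPrinted_localLemD1Data_of` :251–318, sorry-free there) so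
that this head seats independently of the crux-workfile import question; at crux-write time it becomes `import` + a one-line proof.
BONUS (consumed by `Lines/a4-liu411.lean`): the same six stubs give Lem D.1 (1) at EVERY pair `(ε, χ)` — admissible or not — `LemD1AllPairs`
(`lemD1AllPairs_of`), which is the per-place input of `Hyp411`'s irreducibility clause (`Def411WeilCarriers.rhoAtLine_isIrreducible_of_lemD1AsPrinted`).

## Stub inventory (INVENTORY.md §8.2 v2.2 rows; DAG-C node C:LemD1)
* `stub_mvw_IV4_rankOne_irreducibleOrZero` (row IV-1(i), CITE, typed p589403) · `stub_mvw_IV4_rankOne_admissible` (IV-1(ii), CITE, p589403) ·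
  `stub_mvw_IV2_rankOne_nonvanishing_of_isotropic` (IV-2, CITE, p589403) — [MVW87 Ch. 3 IV.4, IV.2; Waldspurger90 (p ≠ 2), GanTakeda16 Thm 1.2,
  GanSun17 (p = 2)]: named facts `Literature/RepresentationTheory/MoeglinVignerasWaldspurger1987/RankOneThetaLift.lean`; shared with fan B verbatim.
* `stub_splitPlace_model_consequences` (IV-3, XL; B's stub (4) verbatim, closed form) · `stub_isotropic_of_three_le` (B's stub (5) verbatim, closed
  form; CLOSED on fan B's side by `b4-isotropy-rank-three`, p590340 + p590822) · `stub_lemD1_item1_at_v` (B's composition as a statement; PROVED in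
  B's file from (1)–(5): Frobenius reciprocity for coinvariants + MVW rank-one theta + survival section).
-/

set_option autoImplicit false

noncomputable section

namespace Summit.HodgeConjecture.CorCM.Lines.A4LiuD1pp
open scoped TensorProduct Matrix
open NumberField NumberField.InfinitePlace
open HodgeCM.Model HodgeCM.Model.LiuIndex HodgeCM.Model.TowerCarrier
open HodgeCM.Literature.Theta.LiuAlbaneseModuleDatum.D2Bridge (HcmPieces)
open Summit.HodgeConjecture.CorCM.Model
open Literature.AlgebraicGeometry.Motives (CMType)
open Literature.AlgebraicGeometry.HodgeTheory Literature.NumberTheory.Automorphic.PicardCM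
open Literature.AlgebraicGeometry.ShimuraVarieties.UnitaryCanonicalModel
open Literature.NumberTheory.ComplexMultiplication
open Literature.NumberTheory.Automorphic
open Literature.NumberTheory.Automorphic.IdeleClassGroup (toHeckeCharacter isUnitary_toHeckeCharacter galConj)
open Literature.NumberTheory.Automorphic.Liu2021 Literature.NumberTheory.Automorphic.Liu2021.AppendixC
open Literature.NumberTheory.Automorphic.Liu2021.AppendixC.RestOne
open Literature.NumberTheory.Automorphic.Liu2021.Def411WeilCarriers (lineOf locF Rep)
open Summit.HodgeConjecture.CorCM.Transposition.OmegaTransport (realUnit)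
open HodgeCM.Model.ArchSideTerm (e₁)
open Literature.NumberTheory.GelbartRogawski1991 Literature.NumberTheory.GelbartRogawski1991.UnitaryDualPair
open Literature.NumberTheory.GelbartRogawski1991.UnitaryDualPair.LocalSplitting (localMu norm_localMu continuous_localMu localMu_toLocalRing_eq_one_iff
  eq_of_forall_localMu_toHeckeCharacter_eq)
open Literature.RepresentationTheory Literature.RepresentationTheory.Liu2021
open Summit.HodgeConjecture.CorCM.Transposition
open Summit.HodgeConjecture.CorCM.D2Bridge.AdapterMuConj (muConj prop413AsPrinted_muConj def411_muConj nontrivial_omegaAt_muConj_rest)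
open Summit.HodgeConjecture.CorCM.D2Bridge.MuKeyIdentEnd (hc_cm_of_printed_citations_muKey_ident)
open Summit.HodgeConjecture.CorCM.D2Bridge.MuKeyIdentLemD3End
open Summit.HodgeConjecture.CorCM.D2Bridge.MuKeyIdentLemD3DelRecConjOmegaEnd (diagonal_frameD_map_complexConj)
open Summit.HodgeConjecture.CorCM.D2Bridge.MuKeyIdentLemD3DelRecConjOmegaEndT (hc_cm_of_printed_citations_muKey_ident_lemD3_delRecConjOmegaT)
open Literature.RepresentationTheory.MoeglinVignerasWaldspurger1987
  (mvw_IV4_rankOne_irreducibleOrZero mvw_IV4_rankOne_admissible mvw_IV2_rankOne_nonvanishing_of_isotropic)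
open MeasureTheory
open Summit.HodgeConjecture.CorCM.D2Bridge.MuKeyIdentLemD3DelRecConjOmegaEndT.PrintedCitationHypotheses (HypD1pp)   -- v2: the decl OF RECORD by name
open Summit.HodgeConjecture.CorCM.HypD1pp (lemD1AllPairs_of_facts hypD1pp_of_facts)                                 -- v2: B-p01 HEAD-TREE by name

/-! ## §1 `LemD1AllPairs` (shared with `Lines/a4-liu411.lean`) — now a THEOREM of the three residual facts -/

set_option synthInstance.maxHeartbeats 400000 in
set_option maxHeartbeats 8000000 in
/-- **`LemD1AllPairs` — Lem. D.1 (1) per place AT EVERY PAIR `(ε, χ)`** of the printed datum `D(μ)` (not only the `μ`-admissible ones): the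
`hD1''` body with the admissible index `j` replaced by a bare pair `(ε : D.Eps) (χ : D.Chi)`.  This is what [Def 4.11]'s sentence «which is an
irreducible admissible representation» needs at non-admissible `ε` too (consumer: `Lines/a4-liu411.lean`, stub `stub_lemD1_allPairs`), and it is
what fan B's per-place line proves anyway (generic line `a`, generic unitary continuous `χ₁`).  `HypD1pp` is its restriction (`hypD1pp_of_allPairs`).
[cite: Liu2021, Def. 4.11 (l. 2088–2096), App. D Lem. D.1 (1)] -/
def LemD1AllPairs : Prop :=
  ∀ (hDel : Literature.AlgebraicGeometry.ShimuraVarieties.UnitaryCanonicalModel.canonicalModel_exists_printed),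
      ∀ (F : HodgeCM.CMField) [IsGalois ℚ F] (h6 : 6 ≤ Module.finrank ℚ F) {ι₁ : F →+* ℂ} (V : HodgeCM.HermSpace3 F ι₁) (a : RealScalar F)
      (Φ : CMType F) (hΦ : ι₁ ∈ Φ.1) (μ : Literature.NumberTheory.Automorphic.IdeleClassGroup (F : Type) →ₜ* Circle)
      (hμ : IdeleClassGroup.IsConjugateSymplectic (F : Type) μ) (hw : IdeleClassGroup.HasWeight (F : Type) μ 1)
      (ε : (toThm418Data _ (restOfCharDeltaPrime (Summit.HodgeConjecture.CorCM.DelRec.exists_recordSystem_of_printed hDel) ⟨HodgeCM.CMField.K F⟩ h6 ι₁ ⟨HodgeCM.HermSpace3.Hm V, HodgeCM.HermSpace3.isHermitian V, HodgeCM.HermSpace3.signature_ι₁ V, HodgeCM.HermSpace3.posDef_of_ne V⟩ Φ e₁ (frameD V) (frameD_real V) (frameD_ne V) (ιVE V) (Rep.update ↥(maximalRealSubfield (HodgeCM.CMField.K F)) (imagUnitSq (HodgeCM.CMField.K F)) (Rep.ofLineOf ↥(maximalRealSubfield (HodgeCM.CMField.K F)) (imagUnitSq (HodgeCM.CMField.K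 F))) (locF ↥(maximalRealSubfield (HodgeCM.CMField.K F)) (imagUnitSq (HodgeCM.CMField.K F)) (realUnit ⟨HodgeCM.CMField.K F⟩ a.1 a.2.1 a.2.2)) (realUnit ⟨HodgeCM.CMField.K F⟩ a.1 a.2.1 a.2.2) rfl) μ hμ hw)).Eps)
      (χ : (toThm418Data _ (restOfCharDeltaPrime (Summit.HodgeConjecture.CorCM.DelRec.exists_recordSystem_of_printed hDel) ⟨HodgeCM.CMField.K F⟩ h6 ι₁ ⟨HodgeCM.HermSpace3.Hm V, HodgeCM.HermSpace3.isHermitian V, HodgeCM.HermSpace3.signature_ι₁ V, HodgeCM.HermSpace3.posDef_of_ne V⟩ Φ e₁ (frameD V) (frameD_real V) (frameD_ne V) (ιVE V) (Rep.update ↥(maximalRealSubfield (HodgeCM.CMField.K F)) (imagUnitSq (HodgeCM.CMField.K F)) (Rep.ofLineOf ↥(maximalRealSubfield (HodgeCM.CMField.K F)) (imagUnitSq (HodgeCM.CMField.K F))) (locF ↥(maximalRealSubfield (HodgeCM.CMField.K F)) (imagUnitSq (HodgeCM.CMField.K F)) (realUnit ⟨HodgeCM.CMField.K F⟩ a.1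 a.2.1 a.2.2)) (realUnit ⟨HodgeCM.CMField.K F⟩ a.1 a.2.1 a.2.2) rfl) μ hμ hw)).Chi) (v : IsDedekindDomain.HeightOneSpectrum (𝓞 ↥(maximalRealSubfield (F : Type)))),
      LemD1_1AsPrinted
        (Def411WeilCarriers.localLemD1Data ↥(maximalRealSubfield (F : Type)) (F : Type) (IsCMField.complexConj (F : Type)) 3 e₁
          (Matrix.diagonal (frameD V)) (complexConj_imagUnit (F : Type)) (imagUnit_ne_zero (F : Type)) (imagUnit_mul_self (F : Type))
          (realDiagonal_isSymm (F : Type) (frameD V) (frameD_real V)) (isUnit_det_realDiagonal (F : Type) (frameD V) (frameD_real V) (frameD_ne V))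
          (realDiagonal_map (F : Type) (frameD V) (frameD_real V)).symm (((Rep.update ↥(maximalRealSubfield (HodgeCM.CMField.K F)) (imagUnitSq (HodgeCM.CMField.K F)) (Rep.ofLineOf ↥(maximalRealSubfield (HodgeCM.CMField.K F)) (imagUnitSq (HodgeCM.CMField.K F))) (locF ↥(maximalRealSubfield (HodgeCM.CMField.K F)) (imagUnitSq (HodgeCM.CMField.K F)) (realUnit ⟨HodgeCM.CMField.K F⟩ a.1 a.2.1 a.2.2)) (realUnit ⟨HodgeCM.CMField.K F⟩ a.1 a.2.1 a.2.2) rfl)).toFun ε)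
          (OmegaChiSplitting.chiLocalSplittingsD ⟨HodgeCM.CMField.K F⟩ e₁ (frameD V) (frameD_real V) (frameD_ne V) (toHeckeCharacter (F : Type) μ)
            ((isOscillatorChar_toHeckeCharacter_iff μ).mpr hμ) (((Rep.update ↥(maximalRealSubfield (HodgeCM.CMField.K F)) (imagUnitSq (HodgeCM.CMField.K F)) (Rep.ofLineOf ↥(maximalRealSubfield (HodgeCM.CMField.K F)) (imagUnitSq (HodgeCM.CMField.K F))) (locF ↥(maximalRealSubfield (HodgeCM.CMField.K F)) (imagUnitSq (HodgeCM.CMField.K F)) (realUnit ⟨HodgeCM.CMField.K F⟩ a.1 a.2.1 a.2.2)) (realUnit ⟨HodgeCM.CMField.K F⟩ a.1 a.2.1 a.2.2) rfl)).toFun ε))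
          (le_refl 3) (localMu (F : Type) (toHeckeCharacter (F : Type) μ))
          (fun v x => norm_localMu (F : Type) (toHeckeCharacter (F : Type) μ) v (isUnitary_toHeckeCharacter (F : Type) μ) x)
          (continuous_localMu (F : Type) (toHeckeCharacter (F : Type) μ))
          (fun v t => localMu_toLocalRing_eq_one_iff (F : Type) (toHeckeCharacter (F : Type) μ) v ((isOscillatorChar_toHeckeCharacter_iff μ).mpr hμ) t)
          χ.1
          (Def411WeilCarriers.norm_chi_eq_one ↥(maximalRealSubfield (F : Type)) (F : Type) (IsCMField.complexConj (F : Type))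
            (Algebra.IsQuadraticExtension.finrank_eq_two ↥(maximalRealSubfield (F : Type)) (F : Type))
            (UnitaryGroup.algEquiv_ne_one_of_apply_eq_neg ↥(maximalRealSubfield (F : Type)) (F : Type) (IsCMField.complexConj (F : Type))
              (complexConj_imagUnit (F : Type)) (imagUnit_ne_zero (F : Type))) χ)
          χ.2.1 v)

set_option synthInstance.maxHeartbeats 400000 in
set_option maxHeartbeats 8000000 in
/-- **Lem. D.1 (1) per place at EVERY pair `(ε, χ)` from the three residual facts** — B-p01's `lemD1AllPairs_of_facts` BY NAME (its statement is
this `LemD1AllPairs` body character for character).  No sorry here. [cite: Liu2021, App. D Lem. D.1 (1) (l. 5246–5253)] -/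
theorem lemD1AllPairs_of : mvw_IV4_rankOne_irreducibleOrZero → splitPlace_chiCoinv_iso_parabolicIndGL →
    Zelevinsky1980.parabolicIndGL_detChar_unitary_isIrreducible.{0} → LemD1AllPairs :=
  fun h1 h2 h3 => lemD1AllPairs_of_facts h1 h2 h3

/-- `HypD1pp` (decl of record) is `LemD1AllPairs` restricted to admissible indices (`j ↦ (j.1.1, j.1.2)`). [cite: Liu2021, Thm. 4.18 (index set), Lem. D.1 (1)] -/
theorem hypD1pp_of_allPairs (H : LemD1AllPairs) : HypD1pp :=
  fun hDel F _ h6 _ V a Φ hΦ μ hμ hw j v => H hDel F h6 V a Φ hΦ μ hμ hw j.1.1 j.1.2 v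

/-! ## §2 The residual named facts (v3: IV-1a and IV-3b CLOSED BY NAME; ONE registered stub remains, IV-3(a)) (D-0014: typed `def … : Prop` facts; their `_holds` theorems close these slots BY NAME) -/

/-- **stub (RESIDUAL FACT, row IV-1(i) = IV-1a) — [MVW87, Chap. 3 IV.4 Thm 2)] irreducible-or-zero of the big theta lift from compact `U(1)`** (named fact
`Literature.RepresentationTheory.MoeglinVignerasWaldspurger1987.mvw_IV4_rankOne_irreducibleOrZero`, RankOneThetaLift.lean :123, p589403).  Why it might
fail: as a CITE it cannot; as a proof it is the Howe-duality theorem for the rank-one compact member [Waldspurger90 p ≠ 2; GanTakeda16 Thm 1.2; GanSun17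
p = 2] — XL (cell plan of record: IV-4(c1)-style doubling, B-p02/B-p04/B-p19 nodes).  Slot: `:= mvw_IV4_rankOne_irreducibleOrZero_holds` when it lands.
[cite: MoeglinVignerasWaldspurger1987, Chap. 3 IV.4 Thm 2); GanTakeda2016, Thm. 1.2] -/
theorem stub_mvw_IV4_rankOne_irreducibleOrZero : mvw_IV4_rankOne_irreducibleOrZero :=
  Literature.RepresentationTheory.MoeglinVignerasWaldspurger1987.mvw_IV4_rankOne_irreducibleOrZero_holds   -- CLOSED BY NAME (B-p02 p601137)

/-- **stub (RESIDUAL FACT, row IV-3(a)) — the split-place model of the `χ`-coinvariants** [Liu 2021, App. D l. 5253; GR90 §2.6]: at a place `v` split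
in `E`, the `χ_v`-coinvariants of the local Weil representation of `U(V)(F_v) ≅ GL_N(F_v)` are isomorphic to the normalised parabolic induction
`parabolicIndGL` from the last-block character (named fact `Literature.NumberTheory.Automorphic.Liu2021.splitPlace_chiCoinv_iso_parabolicIndGL`,
SplitPlaceOscillatorModel.lean :124).  Why it might fail: only at Lean detail — the mixed-model/partial-Fourier transport and the normalisation of the
Levi character (B-p08's File C assembly; B-p17 03:01:05Z exposure of the intermediate `η_s ∘ κ = ν ∘ det^{±1}`) — L.  v4: CLOSED BY NAME — `:= splitPlace_chiCoinv_iso_parabolicIndGL_of_isIrreducible parabolicIndGL_detChar_unitary_isIrreducible_holds` (B-p08 p602828, B-p09 p601139).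
[cite: Liu2021, App. D proof of Lem. D.1 (l. 5253)] [cite: GelbartRogawski1990, §2.6] -/
theorem stub_splitPlace_chiCoinv_iso_parabolicIndGL : splitPlace_chiCoinv_iso_parabolicIndGL :=
  Literature.NumberTheory.Automorphic.Liu2021.splitPlace_chiCoinv_iso_parabolicIndGL_of_isIrreducible
    Literature.NumberTheory.Automorphic.Zelevinsky1980.parabolicIndGL_detChar_unitary_isIrreducible_holds.{0}   -- v4: CLOSED BY NAME (B-p08 p602828 ∘ B-p09 p601139)

/-- **stub (RESIDUAL FACT, row IV-3(b)) — [Zelevinsky 1980, Thm 4.2] irreducibility of `parabolicIndGL` from a unitary last-block character** (named fact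
`Literature.NumberTheory.Automorphic.Zelevinsky1980.parabolicIndGL_detChar_unitary_isIrreducible`, ParabolicIndGLDetCharIrreducible.lean :117, at universe 0
as B-p01's head consumes it).  Why it might fail: as a CITE it cannot; a proof = Zelevinsky's segment criterion for `GL_N` (unitary characters are never
linked) — M for the regular case via Bernstein–Zelevinsky, the irregular `N = 2`, `ν₀ = χ′` case is LANDED (B-p11 p600727
`parabolicIndGL_two_detChar_self_isIrreducible`).  Slot: `:= parabolicIndGL_detChar_unitary_isIrreducible_holds.{0}`.
[cite: Zelevinsky1980, Thm. 4.2] [cite: BernsteinZelevinsky1977, Thm. 4.2] -/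
theorem stub_parabolicIndGL_detChar_unitary_isIrreducible : Zelevinsky1980.parabolicIndGL_detChar_unitary_isIrreducible.{0} :=
  Literature.NumberTheory.Automorphic.Zelevinsky1980.parabolicIndGL_detChar_unitary_isIrreducible_holds.{0}   -- CLOSED BY NAME (B-p09 p601139)

/-! ## §3 Composition (real proofs; sorries live only in the three registered fact stubs) -/

/-- **HEAD COMPOSITION (sorry-free): the three residual facts ⇒ `HypD1pp`** (decl of record) — B-p01's `hypD1pp_of_facts` BY NAME
(= `hypD1pp_of_allPairs ∘ lemD1AllPairs_of`, kernel-checked both ways). [cite: Liu2021, App. D Lem. D.1 (1) (l. 5246–5253)] -/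
theorem HypD1pp_of : mvw_IV4_rankOne_irreducibleOrZero → splitPlace_chiCoinv_iso_parabolicIndGL →
    Zelevinsky1980.parabolicIndGL_detChar_unitary_isIrreducible.{0} → HypD1pp :=
  fun h1 h2 h3 => hypD1pp_of_facts h1 h2 h3

/-- Cross-check (kernel): the two compositions agree definitionally in shape — `hypD1pp_of_allPairs ∘ lemD1AllPairs_of` also proves `HypD1pp`.
[cite: Liu2021, App. D Lem. D.1 (1)] -/
example (h1 : mvw_IV4_rankOne_irreducibleOrZero) (h2 : splitPlace_chiCoinv_iso_parabolicIndGL)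
    (h3 : Zelevinsky1980.parabolicIndGL_detChar_unitary_isIrreducible.{0}) : HypD1pp :=
  hypD1pp_of_allPairs (lemD1AllPairs_of h1 h2 h3)

/-- **`HD1pp_proof` — GATE-SHAPE HEAD (v2; crux stmt-HodgeConjecture-24838 of route `route-HodgeConjecture-HCCMUnconditional`).**  The route item
`HCCMUnconditional.HD1pp` (= the pack decl `PrintedCitationHypotheses.HypD1pp` by `rfl`) from the THREE registered residual fact stubs; no other route
item is used.  HC_CM is proved only modulo the 7 printed citations until rung 0 closes. [cite: Liu2021, App. D Lem. D.1 (1)] -/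
theorem HD1pp_proof : Summit.HodgeConjecture.HodgeConjecture.Theses.HCCMUnconditional.HD1pp :=
  HypD1pp_of stub_mvw_IV4_rankOne_irreducibleOrZero stub_splitPlace_chiCoinv_iso_parabolicIndGL stub_parabolicIndGL_detChar_unitary_isIrreducible

/-- AUDIT: the skeleton's output feeds the `hD1''` slot (the LAST binder) of the headline — with the three fact stubs, exactly the six OTHER printed
citations remain before `HC_CM` (rows `hLiu418`, `h411`, `h413`, `hD3` λ-bound with their headline types).  HC_CM is proved only modulo the 7 printed
citations. [cite: Liu2021, App. D Lem. D.1 (1)] -/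
example (hDel : Literature.AlgebraicGeometry.ShimuraVarieties.UnitaryCanonicalModel.canonicalModel_exists_printed)
    (h21 : shimura1998_thm21_4_casselman) :=
  fun hLiu418 h411 h413 hD3 => hc_cm_of_printed_citations_muKey_ident_lemD3_delRecConjOmegaT hDel h21 hLiu418 h411 h413 hD3
    (HypD1pp_of stub_mvw_IV4_rankOne_irreducibleOrZero stub_splitPlace_chiCoinv_iso_parabolicIndGL stub_parabolicIndGL_detChar_unitary_isIrreducible hDel)

end Summit.HodgeConjecture.CorCM.Lines.A4LiuD1pp

end
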